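import Summits.BirchSwinnertonDyer.BirchSwinnertonDyer.Theorems.ResidualThetaTransportAtTwoResidualSignedLambdaLowerCMAtTwoColemanSidePush
import HarnessLib

/-!
# GLUE clause (7): FIN and COUNT of the one-pair datum `P = Λⁿ × P_{S₀}`, `locd = (𝒸, locdS)` from (nz⁺)/(i_D), S1⊕ and injectivity — packaged
# in the EXACT shape of the supply's clauses `hfinP` / (i) (`Submodule.span A (locd '' Z)`)

Route `ResidualThetaTransportAtTwo` (RTT), crux RSL_g `ResidualSignedLambdaLowerCMAtTwo` (stmt-BirchSwinnertonDyer-22608); LEAD `prover-bsd-wall-rtt-p2` g18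
(`--supports 22608 --as helper`, closes nothing). THEOREMS ONLY; pure module algebra over the landed PUSH (`ColemanSideInjective.finite_and_count_prodQuot`,
`map_fst_span_eq`, `snd_eq_zero_of_fst_eq_zero`, p689690/p690689-lineage, credit k3-g12). GLUE-SPEC-g18 §2 (7). BSD is not proved by any of this.

`finite_and_count_span_locd`: for an additive `locd : H →+ V × P_S` and a subgroup `Z ≤ H` with (LIN) the first components `(locd x).1`, `x ∈ Z`, filling
EXACTLY a `Λ`-submodule `N ≤ V`, (SAT) `Z`'s image saturated under the `A`-action, (INJ) `(locd x).1 = 0 ⟹ x = 0` on `Z`, and the two counts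
`f·(d+e) ≤ λ(V ⧸ N)` ((i_D)), `f·σ ≤ λ(P_S)` (S1⊕) with their finiteness: `K ⊗ (P ⧸ span_A (locd '' Z))` is finite and `f·(d+σ+e) ≤ λ(P ⧸ span_A (locd '' Z))`.
At the pins: `A = ℤ₂`, `K = ℚ₂`, `Λ = ℤ₂⟦X⟧`, `V = Λⁿ`, `P_S = PAway`, `locd = (π.cvec, πₐ.locdS)`, `Z = Λ_𝒪·z`, `N = span 𝒸(Λ_𝒪 z)`, `e = λ_𝒪(Λ_𝒪/D)`.

References: [Washington1997] §13.2; [Kobayashi2003] Thm. 7.3; [Kato2004Asterisque] Thm. 12.5.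
-/

set_option autoImplicit false
-- the Theorems namespace of this sub repeats the summit name by design (D-0017 nested layout)
set_option linter.dupNamespace false

noncomputable section

open scoped TensorProduct

namespace Summit.BirchSwinnertonDyer.BirchSwinnertonDyer.Theorems.OnePair

universe u u' v w

/-- **GLUE clause (7) — FIN and COUNT of the product quotient in the supply's shape.** See the module docstring. Credit: stub-ideation k3 g12 (PUSH);
this is its end-to-end packaging with `L := span_A (locd '' Z)`. [cite: Washington1997, §13.2] [cite: Kobayashi2003, Thm. 7.3 ((7.21), p. 13)] -/
theorem finite_and_count_span_locd {A : Type u} [CommRing A] (K : Type w) [Field K] [Algebra A K] [IsFractionRing A K]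
    {Λ : Type u'} [Ring Λ] {V : Type v} [AddCommGroup V] [Module A V] [Module Λ V] [SMul A Λ] [IsScalarTower A Λ V]
    {PS : Type v} [AddCommGroup PS] [Module A PS] {H : Type*} [AddCommGroup H]
    (locd : H →+ V × PS) (Z : AddSubgroup H) (N : Submodule Λ V)
    (hN : (fun x => (locd x).1) '' (Z : Set H) = (N : Set V))
    (hZ : ∀ (a : A) (x : H), x ∈ Z → ∃ x' ∈ Z, locd x' = a • locd x)
    (hinjZ : ∀ x ∈ Z, (locd x).1 = 0 → x = 0)
    [Module.Finite K (K ⊗[A] (V ⧸ N))] [Module.Finite K (K ⊗[A] PS)]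
    {f d e σ : ℕ} (hQ : f * (d + e) ≤ Module.finrank K (K ⊗[A] (V ⧸ N))) (hS : f * σ ≤ Module.finrank K (K ⊗[A] PS)) :
    Module.Finite K (K ⊗[A] ((V × PS) ⧸ Submodule.span A (locd '' (Z : Set H)))) ∧
      f * (d + σ + e) ≤ Module.finrank K (K ⊗[A] ((V × PS) ⧸ Submodule.span A (locd '' (Z : Set H)))) := by
  have himg : (fun x => ((locd x).1, (locd x).2)) '' (Z : Set H) = locd '' (Z : Set H) :=
    Set.image_congr fun x _ => Prod.mk.eta
  have hfst : (Submodule.span A (locd '' (Z : Set H))).map (LinearMap.fst A V PS) = N.restrictScalars A := by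
    rw [← himg]
    exact ColemanSideInjective.map_fst_span_eq (fun x => (locd x).1) (fun x => (locd x).2) (Z : Set H) N hN
  exact ColemanSideInjective.finite_and_count_prodQuot K (Submodule.span A (locd '' (Z : Set H))) N hfst
    (ColemanSideInjective.snd_eq_zero_of_fst_eq_zero locd Z hZ hinjZ) hQ hS

end Summit.BirchSwinnertonDyer.BirchSwinnertonDyer.Theorems.OnePair

end
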